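import Summits.KontsevichZagierPeriods.KontsevichZagierPeriods.Theses.TerasomaMultiplication

/-!
# `DasGapTwelve` (stmt-KontsevichZagierPeriods-13215) — negative side, part 3: the level-12 lattice certificate

The bookkeeping lattice behind the word "gap" in the crux `DasGapTwelve` of route
`TerasomaMultiplication` (refuter `cdisprove` by-product; work file
`Cruxes/DasGapTwelve/Disproof.lean`).  Coordinates `j : Fin 12` stand for the Gamma monomial
`[j/12] ↦ Γ(j/12)` (Deligne / Koblitz–Ogus Hodge-type classes; `B(a,b) ↦ [a]+[b]−[a+b]`); the
STANDARD relations `S₁₂ = standardSpan` are the `ℤ`-span of the Euler reflections `[x]+[−x]` and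
the Gauss multiplications `Σ_{k<m} [x+k/m] − [mx]`, `m ∈ {2,3,4,6,12}`, `mx ∉ ℤ`.
Machine-checked by `decide`:

* `gapClass_not_mem_standardSpan`: the Yamamoto–Das class `a = [1/12]−[1/4]−[1/3]` is NOT in `S₁₂`
  — the parity functional `χ = m₁+m₅+m₇+m₁₁ (mod 2)` vanishes on every generator and `χ(a) = 1`;
* `betaPairClass_not_mem_standardSpan`: nor is the class `([1]+[3]−[4]) − (2[3]−[6])` of the crux's
  Beta pair `B(1/12,1/4) − B(1/4,1/4)` (it differs from `a` by `[1/2] ∈ S₁₂`);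
* `two_smul_gapClass_mem_standardSpan`: `2a ∈ S₁₂` explicitly (Gauss-3 at 1/12 + Legendre at 1/12
  − reflection at 5/12 + Legendre at 1/6 − reflections at 1/4, 1/3 — the classical derivation of
  `Γ(1/12)²`);
* `gapClass_sub_andersonClass_mem`: modulo `S₁₂`, `a` is Anderson's canonical basis element
  `a_{2·3} = [1/4] − [5/12] − [1/3]` of the 2-torsion of the universal odd distribution (Kubert;
  Das 2000; Anderson 2002, Introduction — where `Γ(a_{2·3}) = Γ(5/12)Γ(1/3)/(√(2π)Γ(1/4))`, i.e.
  `3^(1/4)/c₀`, is displayed): the crux's pair is the `{2,3}` member of that basis.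

So only the SQUARE of the identity is standard: no bookkeeping with multiplication + reflection
(+ translation, + cancellation) at level 12 reaches the crux's pair (recomputed numerically for
all levels `12k ≤ 360`, evidence `num/gap_f2.py` on the item).  This is a statement about the
lattice, NOT about `KZ.relations`: it says where a proof cannot come from, not that none exists.
[Deligne 1982 (Hodge cycles on abelian varieties), Thm 7.18 with the Koblitz–Ogus appendix;
Das 2000; Otsubo–Yamazaki, §8]
-/

noncomputable section

namespace Summit.KontsevichZagierPeriods.TerasomaMultiplication.DasGapTwelveNegative

namespace Lattice12

/-- Basis vector `[i/12]` of the level-12 Gamma-monomial lattice `ℤ^{(1/12)ℤ/ℤ}`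
(coordinate `0`, the integer point, is never used by the generators below). [folklore] -/
def e (i : Fin 12) : Fin 12 → ℤ := fun j => if j = i then 1 else 0

/-- Euler reflection vector `[x] + [-x]` (`Γ(x)Γ(1-x) = π / sin πx`). [folklore] -/
def refl (j : Fin 12) : Fin 12 → ℤ := e j + e (-j)

/-- Gauss multiplication vector `Σ_{k<m} [x + k/m] - [m x]` for `m ∣ 12`
(`Π_k Γ(x+k/m) = (2π)^{(m-1)/2} m^{1/2-mx} Γ(mx)`). [folklore] -/
def mult (m : ℕ) (j : Fin 12) : Fin 12 → ℤ :=
  ((List.range m).map fun k => e (j + Fin.ofNat 12 (k * (12 / m)))).sum - e (Fin.ofNat 12 m * j)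

/-- Generators of the standard relations at level 12: all reflections at `x ≠ 0` and all
multiplications `m ∈ {2,3,4,6,12}` at `x` with `m x ∉ ℤ`. [folklore] -/
def gens : Set (Fin 12 → ℤ) :=
  {v | ∃ j : Fin 12, j ≠ 0 ∧ v = refl j} ∪
  {v | ∃ m : ℕ, m ∈ [2, 3, 4, 6, 12] ∧ ∃ j : Fin 12, Fin.ofNat 12 m * j ≠ 0 ∧ v = mult m j}

/-- The `ℤ`-span `S₁₂` of the standard (reflection + multiplication) relations at level 12. [folklore] -/
def standardSpan : AddSubgroup (Fin 12 → ℤ) := AddSubgroup.closure gens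

/-- The Yamamoto–Das gap class `a = [1/12] - [1/4] - [1/3]` (Hodge type, weight `-1/2`). [folklore] -/
def gapClass : Fin 12 → ℤ := e 1 - e 3 - e 4

/-- The class of the crux's Beta pair `B(1/12,1/4) - B(1/4,1/4)`:
`([1]+[3]-[4]) - (2[3]-[6])`. [folklore] -/
def betaPairClass : Fin 12 → ℤ := (e 1 + e 3 - e 4) - (2 • e 3 - e 6)

/-- The parity functional `χ(v) = v₁ + v₅ + v₇ + v₁₁ mod 2`, as the subgroup `{χ = 0}`. [folklore] -/
def parity : AddSubgroup (Fin 12 → ℤ) where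
  carrier := {v | 2 ∣ v 1 + v 5 + v 7 + v 11}
  add_mem' := by
    intro a b ha hb
    simp only [Set.mem_setOf_eq, Pi.add_apply] at *
    obtain ⟨k, hk⟩ := ha
    obtain ⟨l, hl⟩ := hb
    exact ⟨k + l, by linarith⟩
  zero_mem' := by simp
  neg_mem' := by
    intro a ha
    simp only [Set.mem_setOf_eq, Pi.neg_apply] at *
    obtain ⟨k, hk⟩ := ha
    exact ⟨-k, by linarith⟩

/-- The parity functional vanishes on every reflection vector. [folklore] -/
theorem refl_even : ∀ j : Fin 12, 2 ∣ refl j 1 + refl j 5 + refl j 7 + refl j 11 := by decide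

/-- The parity functional vanishes on every multiplication vector at level 12. [folklore] -/
theorem mult_even : ∀ m ∈ [2, 3, 4, 6, 12], ∀ j : Fin 12, Fin.ofNat 12 m * j ≠ 0 →
    2 ∣ mult m j 1 + mult m j 5 + mult m j 7 + mult m j 11 := by decide

/-- Every standard generator lies in the parity subgroup. [folklore] -/
theorem gens_subset_parity : gens ⊆ parity := by
  rintro v (⟨j, -, rfl⟩ | ⟨m, hm, j, hj, rfl⟩)
  · exact refl_even j
  · exact mult_even m hm j hj

/-- `S₁₂ ≤ {χ = 0}`. [folklore] -/
theorem standardSpan_le_parity : standardSpan ≤ parity :=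
  (AddSubgroup.closure_le parity).mpr gens_subset_parity

/-- **The gap class is not a standard relation at level 12** (parity certificate). [folklore] -/
theorem gapClass_not_mem_standardSpan : gapClass ∉ standardSpan := fun h => by
  have h2 : (2:ℤ) ∣ gapClass 1 + gapClass 5 + gapClass 7 + gapClass 11 := standardSpan_le_parity h
  revert h2
  decide

/-- **Nor is the Beta-pair class of the crux** (it differs from `gapClass` by `[1/2] ∈ S₁₂`). [folklore] -/
theorem betaPairClass_not_mem_standardSpan : betaPairClass ∉ standardSpan := fun h => by
  have h2 : (2:ℤ) ∣ betaPairClass 1 + betaPairClass 5 + betaPairClass 7 + betaPairClass 11 :=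
    standardSpan_le_parity h
  revert h2
  decide

/-- Reflection vectors are standard relations. [folklore] -/
theorem refl_mem (j : Fin 12) (hj : j ≠ 0) : refl j ∈ standardSpan :=
  AddSubgroup.subset_closure (Or.inl ⟨j, hj, rfl⟩)

/-- Multiplication vectors are standard relations. [folklore] -/
theorem mult_mem (m : ℕ) (hm : m ∈ [2, 3, 4, 6, 12]) (j : Fin 12) (hj : Fin.ofNat 12 m * j ≠ 0) :
    mult m j ∈ standardSpan :=
  AddSubgroup.subset_closure (Or.inr ⟨m, hm, j, hj, rfl⟩)

/-- **Only the square is standard**: `2a ∈ S₁₂`, by the classical derivation of `Γ(1/12)²`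
(Gauss-3 at 1/12, Legendre at 1/12 and 1/6, reflections at 5/12, 1/4, 1/3). [folklore] -/
theorem two_smul_gapClass_mem_standardSpan : (2 : ℕ) • gapClass ∈ standardSpan := by
  have key : (2 : ℕ) • gapClass = mult 3 1 + mult 2 1 - refl 5 + mult 2 2 - refl 3 - refl 4 := by
    decide
  rw [key]
  refine sub_mem (sub_mem (add_mem (sub_mem (add_mem ?_ ?_) ?_) ?_) ?_) ?_
  · exact mult_mem 3 (by decide) 1 (by decide)
  · exact mult_mem 2 (by decide) 1 (by decide)
  · exact refl_mem 5 (by decide)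
  · exact mult_mem 2 (by decide) 2 (by decide)
  · exact refl_mem 3 (by decide)
  · exact refl_mem 4 (by decide)

/-- `[1/2] ∈ S₁₂` (`refl 3 - mult 2 3`), so `betaPairClass ≡ gapClass (mod S₁₂)`. [folklore] -/
theorem betaPairClass_sub_gapClass_mem : betaPairClass - gapClass ∈ standardSpan := by
  have key : betaPairClass - gapClass = refl 3 - mult 2 3 := by decide
  rw [key]
  exact sub_mem (refl_mem 3 (by decide)) (mult_mem 2 (by decide) 3 (by decide))

/-- Anderson's canonical basis element `a_{2·3} = [1/4] - [5/12] - [1/3]` of the 2-torsion of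
the universal odd distribution `U⁻` (Kubert: the torsion of `U⁻` is killed by 2; Das 2000 /
Anderson 2002: the classes `a_{pq}`, `p < q` prime, form its canonical `ℤ/2`-basis; `{p,q} =
{2,3}` is level 12), read in this lattice.  In Anderson's normalisation `Γ[a] = √(2π)/Γ(a)` one has
`Γ(a_{2·3}) = Γ(5/12)Γ(1/3)/(√(2π)Γ(1/4)) = 2^(-1/4)3^(1/8)√(sin(π/4)/(2 sin(5π/12) sin(π/3)))`
(Anderson 2002, Introduction), which equals `3^(1/4)/c₀` for the crux's constant `c₀`
(`Γ(1/12)Γ(5/12) = √2·3^(1/4)Γ(1/4)²`; checked to 1e-16).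
[cite: Anderson2002KroneckerWeberEpsilon, Introduction] -/
def andersonClass : Fin 12 → ℤ := e 3 - e 5 - e 4

/-- The crux's gap class IS Anderson's `a_{2·3}` modulo the standard relations of this lattice:
`gapClass - andersonClass = mult 3 1 - refl 3` (Gauss-3 at 1/12 minus the reflection at 1/4).
[cite: Anderson2002KroneckerWeberEpsilon, Introduction] -/
theorem gapClass_sub_andersonClass_mem : gapClass - andersonClass ∈ standardSpan := by
  have key : gapClass - andersonClass = mult 3 1 - refl 3 := by decide
  rw [key]
  exact sub_mem (mult_mem 3 (by decide) 1 (by decide)) (refl_mem 3 (by decide))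

/-- Anderson's class is not a standard relation at level 12 either (parity certificate).
[cite: Anderson2002KroneckerWeberEpsilon, Introduction] -/
theorem andersonClass_not_mem_standardSpan : andersonClass ∉ standardSpan := fun h => by
  have h2 : (2:ℤ) ∣ andersonClass 1 + andersonClass 5 + andersonClass 7 + andersonClass 11 :=
    standardSpan_le_parity h
  revert h2
  decide

end Lattice12

end Summit.KontsevichZagierPeriods.TerasomaMultiplication.DasGapTwelveNegative
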